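import Literature.Barriers.AtomisticToContinuum.DisorderedHarmonicChainResonantSet
import Literature.Barriers.AtomisticToContinuum.DisorderedHarmonicChainLowerMain
import HarnessLib

/-!
# Ajanki–Huveneers 2011, §6.1 discharged: the resonant set has probability `≳ w²`, hence (L)

With Prop. 5.1 now PROVED in the two instances §6.1 of O. Ajanki, F. Huveneers, CMP **301** (2011)
841–883 (arXiv:1003.1076) actually uses — the upper bound (5.1) (`potentialTheory_upper`,
`…PotentialUpper.lean`) and the lower bound (5.2) for the untilted chain
(`potentialTheory_lower_zero`, `…LowerMain.lean`) — the reduction of `…ResonantSet.lean` closes: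
`AjankiHuveneers2011_resonantSetProbability_holds` and
`AjankiHuveneers2011_criticalBandLowerBound_holds` ((L) of the summit route). The proof of
`…_of_tails` below is the proof of `…ResonantSet.lean`'s `…_of_inputs` verbatim, with the three
invocations of the named fact replaced by the two theorems.

[cite: AjankiHuveneers2011, §6.1, the two displays following (6.9), with Prop. 5.1 and Lemma 6.1]
-/

noncomputable section

open MeasureTheory Finset Real

namespace Literature.Barriers.AtomisticToContinuum

open Literature.MathematicalPhysics.KineticTheory.HeatConduction HeatConduction

/-- (Copy of `AjankiHuveneers2011_resonantSetProbability_of_inputs` of `…ResonantSet.lean` with the named fact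
`AjankiHuveneers2011_potentialTheory` replaced by the two PROVED instances it is used at: the lower bound (5.2)
with `h ≡ 0`, `potentialTheory_lower_zero`, and the upper bound (5.1), `potentialTheory_upper`.)
**The last two displays of §6.1, PROVED from their inputs**: Prop. 5.1 (`h5`), Lemma 3.7 with
Lemma 6.1 in the tail form (6.8)–(6.9) (`hJ`) and the positivity `X^ϑ_n - X^0_n > 0` of (3.25) (`hpos`)
imply `P(E_n) ≥ Kw²` on the band `1/2 ≤ w²n ≤ 1`:
"`P(E_n) ≥ P(|X^ϑ_n|_𝕋 ≤ w², Γ^ϑ_n ≤ R, e^{M_n} ≤ R, |L_n| ≤ 1, |K_n| ≤ 1) ≥ P(|X^ϑ_n|_𝕋 ≤ w²) -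
P(|L_n| > 1) - P(|K_n| > 1) - P(|X^ϑ_n|_𝕋 ≤ w², Γ^ϑ_n > R) - P(|X^ϑ_n|_𝕋 ≤ w², e^{M_n} > R)`.
Applying then Markov's inequality to the two last terms, one gets `… - R⁻¹𝔼[χ_{B(0,w²)}(X^ϑ_n)Γ^ϑ_n] -
R⁻¹𝔼[χ_{B(0,w²)}(X^ϑ_n)e^{M_n}]`. Proposition 5.1 and Lemma 6.1 allow then to conclude … if `R` is
chosen large enough": Prop. 5.1 is used three times with `u = χ_{B̄(0,w²)}` (`∫_𝕋 u ∈ [w², 2w²]`), `x = ϑ`: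
lower bound with `h ≡ 0` (`P(|X^ϑ_n|_𝕋 ≤ w²) ≥ K'w²`), upper bound with `h = φ'` (`𝔼[u(X_n)e^{M_n}] ≤
2√2Kw²`) and with `h = s` (`Γ_n ≤ E₀e^{w∑s(X)B}`, `rs_ahGamma_le_exp`); the tails cost `2Cw³`;
`R = max{1, 8√2(K_φ' + E₀K_s)/K'}`, `c = c₀R + 1`, `K = K'/2`.
[cite: AjankiHuveneers2011, §6.1, the two displays following (6.9), with Prop. 5.1 and Lemma 6.1] -/
theorem AjankiHuveneers2011_resonantSetProbability_of_tails
    (hJ : AjankiHuveneers2011_jointBehaviourTails)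
    (hpos : ∀ bm bp : ℝ, ∃ w₀ : ℝ, 0 < w₀ ∧ ∀ w ∈ Set.Ioc 0 w₀, ∀ B : ℕ → ℝ,
      (∀ k, B k ∈ Set.Icc bm bp) → ∀ n, 0 < ahPhase w (ahTheta w) B n - ahPhase w 0 B n) :
    AjankiHuveneers2011_resonantSetProbability := by
  intro τ bm bp hτ ρB _ hρ
  have hκ : (0 : ℝ) < 1 / 2 := by norm_num
  -- Prop. 5.1 three times (κ = 1/2): `h ≡ 0` (lower bound), `h = φ'` (for `e^{M_n}`), `h = s` (for `Γ_n`)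
  obtain ⟨K₀', w₀, hK₀', hw₀, h50⟩ := potentialTheory_lower_zero τ bm bp hτ ρB hρ
  obtain ⟨K₁, w₁, hK₁, hw₁, h51⟩ :=
    potentialTheory_upper τ bm bp hτ ρB hρ (1 / 2) hκ (fun y : ℝ => π * Real.sin (2 * π * y)) periodic_pi_mul_sin
      contDiff_pi_mul_sin
  obtain ⟨K₂, w₂, hK₂, hw₂, h52⟩ :=
    potentialTheory_upper τ bm bp hτ ρB hρ (1 / 2) hκ ahS periodic_ahS contDiff_ahS
  -- (3.21): `Γ ≤ E₀ e^{w ∑ s(X)B}`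
  obtain ⟨w₃, hw₃, E₀, hE₀, hE⟩ := rs_ahGamma_le_exp bm bp hτ.lo hτ.lt
  -- Lemma 3.7 + Lemma 6.1 with `α = 3`
  obtain ⟨C, c₀, w₄, hC, hc₀, hw₄, hJ'⟩ := hJ τ bm bp hτ ρB hρ 3 (by norm_num)
  -- `d_n = X^ϑ_n - X^0_n > 0`
  obtain ⟨w₅, hw₅, hΘ⟩ := hpos bm bp
  -- constants
  have hE₀0 : 0 ≤ E₀ := zero_le_one.trans hE₀
  set L : ℝ := 2 * Real.sqrt 2 * (K₁ + E₀ * K₂) with hL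
  have hL0 : 0 ≤ L := by positivity
  set R : ℝ := max 1 (4 * L / K₀') with hR
  have hR1 : 1 ≤ R := le_max_left _ _
  have hR0 : 0 < R := by positivity
  have hRL : 4 * L / K₀' ≤ R := le_max_right _ _
  set w₆ : ℝ := K₀' / (8 * C) with hw₆
  have hw₆0 : 0 < w₆ := by positivity
  set ws : ℝ := min (min (min (min w₀ w₁) (min w₂ w₃)) (min (min w₄ w₅) w₆)) (1 / 2) with hws
  refine ⟨R, c₀ * R + 1, K₀' / 2, ws, by positivity, by positivity, ?_⟩
  intro w hw n hn1 hn2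
  obtain ⟨hw0, hwle⟩ := hw
  have hA₁ : ws ≤ min (min w₀ w₁) (min w₂ w₃) := (min_le_left _ _).trans (min_le_left _ _)
  have hA₂ : ws ≤ min (min w₄ w₅) w₆ := (min_le_left _ _).trans (min_le_right _ _)
  have hww₀ : w ∈ Set.Ioc 0 w₀ := ⟨hw0, hwle.trans (hA₁.trans ((min_le_left _ _).trans (min_le_left _ _)))⟩
  have hww₁ : w ∈ Set.Ioc 0 w₁ := ⟨hw0, hwle.trans (hA₁.trans ((min_le_left _ _).trans (min_le_right _ _)))⟩
  have hww₂ : w ∈ Set.Ioc 0 w₂ := ⟨hw0, hwle.trans (hA₁.trans ((min_le_right _ _).trans (min_le_left _ _)))⟩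
  have hww₃ : w ∈ Set.Ioc 0 w₃ := ⟨hw0, hwle.trans (hA₁.trans ((min_le_right _ _).trans (min_le_right _ _)))⟩
  have hww₄ : w ∈ Set.Ioc 0 w₄ := ⟨hw0, hwle.trans (hA₂.trans ((min_le_left _ _).trans (min_le_left _ _)))⟩
  have hww₅ : w ∈ Set.Ioc 0 w₅ := ⟨hw0, hwle.trans (hA₂.trans ((min_le_left _ _).trans (min_le_right _ _)))⟩
  have hww₆ : w ≤ w₆ := hwle.trans (hA₂.trans (min_le_right _ _))
  have hw12 : w ≤ 1 / 2 := hwle.trans (min_le_right _ _)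
  have hw1 : w ≤ 1 := by linarith
  have hwsq : w ^ 2 < 1 := by nlinarith
  -- `n ≥ 1`, `κ ≤ wn`, `1/(w√n) ≤ √2`
  have hn : 1 ≤ n := by
    rcases Nat.eq_zero_or_pos n with h | h
    · subst h; norm_num at hn1
    · exact h
  have hn0 : (0 : ℝ) < n := by exact_mod_cast hn
  have hκn : 1 / 2 ≤ w * n := by
    calc (1 : ℝ) / 2 ≤ w ^ 2 * n := hn1
      _ = w * (w * n) := by ring
      _ ≤ 1 * (w * n) := mul_le_mul_of_nonneg_right hw1 (by positivity)
      _ = w * n := one_mul _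
  have hwsn : 1 / (w * Real.sqrt n) ≤ Real.sqrt 2 := rs_one_div_mul_sqrt_le hw0 hn0 hn1
  -- the window `u = χ_{B̄(0,w²)}` on `𝕋`
  set u : ℝ → ℝ := fun y => if ‖(y : UnitAddCircle)‖ ≤ w ^ 2 then 1 else 0 with hudef
  have hu : ∀ y, u y = if ‖(y : UnitAddCircle)‖ ≤ w ^ 2 then 1 else 0 := fun y => rfl
  have hwsn' : ∀ {K : ℝ}, 0 ≤ K → K / (w * Real.sqrt n) * ∫ y in Set.Ico (0 : ℝ) 1, u y ≤
      K * Real.sqrt 2 * (2 * w ^ 2) := by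
    intro K hK
    have hI0 : 0 ≤ ∫ y in Set.Ico (0 : ℝ) 1, u y :=
      setIntegral_nonneg measurableSet_Ico fun y _ => rsWin_nonneg hu y
    calc K / (w * Real.sqrt n) * ∫ y in Set.Ico (0 : ℝ) 1, u y
        = K * (1 / (w * Real.sqrt n)) * ∫ y in Set.Ico (0 : ℝ) 1, u y := by ring
      _ ≤ K * Real.sqrt 2 * (2 * w ^ 2) :=
          mul_le_mul (mul_le_mul_of_nonneg_left hwsn hK) (integral_rsWin_le hu) hI0 (by positivity)
  -- the probability space and the events
  set μ : Measure (Fin n → ℝ) := Measure.pi fun _ : Fin n => ρB with hμ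
  set A : Set (Fin n → ℝ) :=
    {B | ‖(ahPhase w (ahTheta w) (finExt B) n : UnitAddCircle)‖ ≤ w ^ 2} with hAdef
  set E : Set (Fin n → ℝ) :=
    {B | ‖(ahPhase w (ahTheta w) (finExt B) n : UnitAddCircle)‖ ≤ w ^ 2 ∧
      ahGamma w (ahTheta w) (finExt B) n ≤ R ∧
      ‖(ahPhase w 0 (finExt B) n : UnitAddCircle)‖ ≤ (c₀ * R + 1) * w ∧
      ahGamma w 0 (finExt B) n ≤ (c₀ * R + 1) * R} with hEdef
  set fΓ : (Fin n → ℝ) → ℝ := fun B =>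
    u (ahPhase w (ahTheta w) (finExt B) n) * |ahGamma w (ahTheta w) (finExt B) n| with hfΓ
  set fM : (Fin n → ℝ) → ℝ := fun B =>
    Real.exp (w * ∑ k ∈ Finset.range n,
      (fun y : ℝ => π * Real.sin (2 * π * y)) (ahPhase w (ahTheta w) (finExt B) k) * finExt B k) *
      u (ahPhase w (ahTheta w) (finExt B) n) with hfM
  set G₂ : (Fin n → ℝ) → ℝ := fun B =>
    Real.exp (w * ∑ k ∈ Finset.range n, ahS (ahPhase w (ahTheta w) (finExt B) k) * finExt B k) *
      u (ahPhase w (ahTheta w) (finExt B) n) with hG₂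
  set SΓ : Set (Fin n → ℝ) := {B | R ≤ fΓ B} with hSΓ
  set SM : Set (Fin n → ℝ) := {B | R ≤ fM B} with hSM
  set Exc₁ : Set (Fin n → ℝ) :=
    {B | Real.exp (ahMart w (finExt B) n) ≤ R ∧
      c₀ * R * w < ahPhase w (ahTheta w) (finExt B) n - ahPhase w 0 (finExt B) n} with hExc₁
  set Exc₂ : Set (Fin n → ℝ) :=
    {B | c₀ * ahGamma w (ahTheta w) (finExt B) n < ahGamma w 0 (finExt B) n} with hExc₂
  have hMart : ∀ B : Fin n → ℝ, w * ∑ k ∈ Finset.range n,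
      (fun y : ℝ => π * Real.sin (2 * π * y)) (ahPhase w (ahTheta w) (finExt B) k) * finExt B k =
      ahMart w (finExt B) n := fun B => rfl
  -- Prop. 5.1: the three expectations
  obtain ⟨-, hB₀⟩ := h50 w hww₀ u (rsWin_periodic hu) (rsWin_nonneg hu) (integrableOn_rsWin hu)
    (ahTheta w) n hn1 hn2
  obtain ⟨hI₁, hB₁⟩ := h51 w hww₁ u (rsWin_periodic hu) (rsWin_nonneg hu) (integrableOn_rsWin hu)
    (ahTheta w) n hκn hn2
  obtain ⟨hI₂, hB₂⟩ := h52 w hww₂ u (rsWin_periodic hu) (rsWin_nonneg hu) (integrableOn_rsWin hu)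
    (ahTheta w) n hκn hn2
  -- (i) `P(A) ≥ K₀' w²`
  have hA_meas : MeasurableSet A :=
    (measurable_ahPhase_pi w (ahTheta w) n) (measurableSet_rsBall w)
  have hPA : K₀' * w ^ 2 ≤ μ.real A := by
    have h1 : (fun B : Fin n → ℝ => Real.exp (w * ∑ k ∈ Finset.range n,
        (fun _ : ℝ => (0 : ℝ)) (ahPhase w (ahTheta w) (finExt B) k) * finExt B k) *
        u (ahPhase w (ahTheta w) (finExt B) n)) =
        fun B => A.indicator 1 B := by
      funext B
      simp only [zero_mul, Finset.sum_const_zero, mul_zero, Real.exp_zero, one_mul]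
      rw [rsWin_eq_indicator hu]
      rfl
    rw [h1, integral_indicator_one hA_meas] at hB₀
    calc K₀' * w ^ 2 ≤ K₀' * ∫ y in Set.Ico (0 : ℝ) 1, u y :=
          mul_le_mul_of_nonneg_left (sq_le_integral_rsWin hu hwsq) hK₀'.le
      _ ≤ μ.real A := hB₀
  -- (ii) Markov for `Γ`: `R P(A ∩ {Γ > R}) ≤ 𝔼[u(X_n)Γ_n] ≤ E₀ 𝔼[u(X_n)e^{w∑sB}] ≤ 2√2 E₀K₂ w²`
  have hfΓ_meas : Measurable fΓ :=
    ((measurable_rsWin hu).comp (measurable_ahPhase_pi w (ahTheta w) n)).mul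
      (continuous_abs.measurable.comp (ig_measurable_ahGamma w (ahTheta w) n n))
  have hfΓ_le : ∀ᵐ B ∂μ, fΓ B ≤ E₀ * G₂ B := by
    filter_upwards [ae_pi_mem_Icc hτ.eq_zero hρ n] with β hβ
    have hBk : ∀ k, finExt β k ∈ Set.Icc bm bp := finExt_mem_Icc hτ.bm_nonpos hτ.bp_nonneg hβ
    obtain ⟨hΓpos, hΓ⟩ := hE w hww₃ (ahTheta w) (finExt β) hBk n hn2
    have hu0 := rsWin_nonneg hu (ahPhase w (ahTheta w) (finExt β) n)
    show u (ahPhase w (ahTheta w) (finExt β) n) * |ahGamma w (ahTheta w) (finExt β) n| ≤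
      E₀ * (Real.exp (w * ∑ k ∈ Finset.range n, ahS (ahPhase w (ahTheta w) (finExt β) k) * finExt β k) *
        u (ahPhase w (ahTheta w) (finExt β) n))
    rw [abs_of_pos hΓpos]
    calc u (ahPhase w (ahTheta w) (finExt β) n) * ahGamma w (ahTheta w) (finExt β) n
        ≤ u (ahPhase w (ahTheta w) (finExt β) n) *
            (E₀ * Real.exp (w * ∑ k ∈ Finset.range n, ahS (ahPhase w (ahTheta w) (finExt β) k) * finExt β k)) :=
          mul_le_mul_of_nonneg_left hΓ hu0
      _ = _ := by ring
  have hfΓ_nonneg : ∀ B, 0 ≤ fΓ B := fun B => mul_nonneg (rsWin_nonneg hu _) (abs_nonneg _)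
  have hfΓ_int : Integrable fΓ μ := by
    refine Integrable.mono' (hI₂.const_mul E₀) hfΓ_meas.aestronglyMeasurable ?_
    filter_upwards [hfΓ_le] with B hB
    rw [Real.norm_eq_abs, abs_of_nonneg (hfΓ_nonneg B)]
    exact hB
  have hPΓ : μ.real SΓ ≤ E₀ * K₂ * Real.sqrt 2 * (2 * w ^ 2) / R := by
    have hMk := mul_meas_ge_le_integral_of_nonneg (μ := μ) (ae_of_all _ hfΓ_nonneg) hfΓ_int R
    rw [le_div_iff₀ hR0, mul_comm]
    calc R * μ.real SΓ ≤ ∫ B, fΓ B ∂μ := hMk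
      _ ≤ ∫ B, E₀ * G₂ B ∂μ := integral_mono_ae hfΓ_int (hI₂.const_mul E₀) hfΓ_le
      _ = E₀ * ∫ B, G₂ B ∂μ := integral_const_mul _ _
      _ ≤ E₀ * (K₂ / (w * Real.sqrt n) * ∫ y in Set.Ico (0 : ℝ) 1, u y) :=
          mul_le_mul_of_nonneg_left hB₂ hE₀0
      _ ≤ E₀ * (K₂ * Real.sqrt 2 * (2 * w ^ 2)) := mul_le_mul_of_nonneg_left (hwsn' hK₂.le) hE₀0
      _ = E₀ * K₂ * Real.sqrt 2 * (2 * w ^ 2) := by ring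
  -- (iii) Markov for `e^{M_n}`: `R P(A ∩ {e^M > R}) ≤ 𝔼[u(X_n)e^{M_n}] ≤ 2√2 K₁ w²`
  have hfM_nonneg : ∀ B, 0 ≤ fM B := fun B => mul_nonneg (Real.exp_pos _).le (rsWin_nonneg hu _)
  have hPM : μ.real SM ≤ K₁ * Real.sqrt 2 * (2 * w ^ 2) / R := by
    have hMk := mul_meas_ge_le_integral_of_nonneg (μ := μ) (ae_of_all _ hfM_nonneg) hI₁ R
    rw [le_div_iff₀ hR0, mul_comm]
    calc R * μ.real SM ≤ ∫ B, fM B ∂μ := hMk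
      _ ≤ K₁ / (w * Real.sqrt n) * ∫ y in Set.Ico (0 : ℝ) 1, u y := hB₁
      _ ≤ K₁ * Real.sqrt 2 * (2 * w ^ 2) := hwsn' hK₁.le
  -- (iv) the tails of Lemma 6.1
  obtain ⟨hJ₁, hJ₂⟩ := hJ' w hww₄ n hn hn2
  have hw3 : w ^ (3 : ℝ) = w ^ (3 : ℕ) := by exact_mod_cast Real.rpow_natCast w 3
  have hCw : C * w ^ (3 : ℝ) ≤ K₀' / 8 * w ^ 2 := by
    rw [hw3]
    have h1 : C * w ≤ K₀' / 8 := by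
      calc C * w ≤ C * w₆ := mul_le_mul_of_nonneg_left hww₆ hC.le
        _ = K₀' / 8 := by rw [hw₆]; field_simp
    calc C * w ^ 3 = C * w * w ^ 2 := by ring
      _ ≤ K₀' / 8 * w ^ 2 := mul_le_mul_of_nonneg_right h1 (sq_nonneg w)
  have hP₁ : μ.real Exc₁ ≤ K₀' / 8 * w ^ 2 := (hJ₁ R).trans hCw
  have hP₂ : μ.real Exc₂ ≤ K₀' / 8 * w ^ 2 := hJ₂.trans hCw
  -- (v) the inclusion `A ⊆ E ∪ SΓ ∪ SM ∪ Exc₁ ∪ Exc₂` a.e. ((6.8)–(6.9))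
  have hincl : ∀ᵐ B ∂μ, B ∈ A → B ∈ E ∨ B ∈ SΓ ∨ B ∈ SM ∨ B ∈ Exc₁ ∨ B ∈ Exc₂ := by
    filter_upwards [ae_pi_mem_Icc hτ.eq_zero hρ n] with β hβ hβA
    have hBk : ∀ k, finExt β k ∈ Set.Icc bm bp := finExt_mem_Icc hτ.bm_nonpos hτ.bp_nonneg hβ
    have hXA : ‖(ahPhase w (ahTheta w) (finExt β) n : UnitAddCircle)‖ ≤ w ^ 2 := hβA
    have hu1 : u (ahPhase w (ahTheta w) (finExt β) n) = 1 := rsWin_of_le hu hXA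
    by_cases hΓ : R < ahGamma w (ahTheta w) (finExt β) n
    · refine Or.inr (Or.inl ?_)
      show R ≤ u (ahPhase w (ahTheta w) (finExt β) n) * |ahGamma w (ahTheta w) (finExt β) n|
      rw [hu1, one_mul]
      exact hΓ.le.trans (le_abs_self _)
    have hΓ' : ahGamma w (ahTheta w) (finExt β) n ≤ R := not_lt.mp hΓ
    by_cases hM : R < Real.exp (ahMart w (finExt β) n)
    · refine Or.inr (Or.inr (Or.inl ?_))
      show R ≤ Real.exp (w * ∑ k ∈ Finset.range n,
        (fun y : ℝ => π * Real.sin (2 * π * y)) (ahPhase w (ahTheta w) (finExt β) k) * finExt β k) *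
        u (ahPhase w (ahTheta w) (finExt β) n)
      rw [hMart β, hu1, mul_one]
      exact hM.le
    have hM' : Real.exp (ahMart w (finExt β) n) ≤ R := not_lt.mp hM
    by_cases hd : c₀ * R * w < ahPhase w (ahTheta w) (finExt β) n - ahPhase w 0 (finExt β) n
    · exact Or.inr (Or.inr (Or.inr (Or.inl ⟨hM', hd⟩)))
    have hd' : ahPhase w (ahTheta w) (finExt β) n - ahPhase w 0 (finExt β) n ≤ c₀ * R * w := not_lt.mp hd
    by_cases hG : c₀ * ahGamma w (ahTheta w) (finExt β) n < ahGamma w 0 (finExt β) n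
    · exact Or.inr (Or.inr (Or.inr (Or.inr hG)))
    have hG' : ahGamma w 0 (finExt β) n ≤ c₀ * ahGamma w (ahTheta w) (finExt β) n := not_lt.mp hG
    refine Or.inl ⟨hXA, hΓ', ?_, ?_⟩
    · exact rs_norm_X0_le hw0.le hw1 hXA (hΘ w hww₅ (finExt β) hBk n).le hd'
    · calc ahGamma w 0 (finExt β) n ≤ c₀ * ahGamma w (ahTheta w) (finExt β) n := hG'
        _ ≤ c₀ * R := mul_le_mul_of_nonneg_left hΓ' hc₀.le
        _ = c₀ * R * 1 + 0 := by ring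
        _ ≤ c₀ * R * R + R := add_le_add (mul_le_mul_of_nonneg_left hR1 (by positivity)) hR0.le
        _ = (c₀ * R + 1) * R := by ring
  have hsplit := rs_measureReal_le_of_ae_imp₅ μ hincl
  -- (vi) assembly
  have hloss : μ.real SΓ + μ.real SM ≤ K₀' / 4 * w ^ 2 := by
    have h1 : μ.real SΓ + μ.real SM ≤ L * w ^ 2 / R := by
      calc μ.real SΓ + μ.real SM
          ≤ E₀ * K₂ * Real.sqrt 2 * (2 * w ^ 2) / R + K₁ * Real.sqrt 2 * (2 * w ^ 2) / R :=
            add_le_add hPΓ hPM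
        _ = L * w ^ 2 / R := by rw [hL]; ring
    have h2 : L * w ^ 2 / R ≤ K₀' / 4 * w ^ 2 := by
      rw [div_le_iff₀ hR0]
      have h3 : 4 * L ≤ R * K₀' := by
        have := hRL
        rwa [div_le_iff₀ hK₀'] at this
      have h4 : L ≤ R * K₀' / 4 := by linarith only [h3]
      calc L * w ^ 2 ≤ R * K₀' / 4 * w ^ 2 := mul_le_mul_of_nonneg_right h4 (sq_nonneg w)
        _ = K₀' / 4 * w ^ 2 * R := by ring
    exact h1.trans h2
  have hfin : K₀' * w ^ 2 - K₀' / 4 * w ^ 2 - K₀' / 8 * w ^ 2 - K₀' / 8 * w ^ 2 ≤ μ.real E := by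
    linarith only [hPA, hsplit, hloss, hP₁, hP₂]
  calc K₀' / 2 * w ^ 2 = K₀' * w ^ 2 - K₀' / 4 * w ^ 2 - K₀' / 8 * w ^ 2 - K₀' / 8 * w ^ 2 := by ring
    _ ≤ μ.real E := hfin

/-- **§6.1, the resonant set has probability `≳ w²`** — DISCHARGED.
[cite: AjankiHuveneers2011, §6.1, the two displays following (6.9)] -/
theorem AjankiHuveneers2011_resonantSetProbability_holds : AjankiHuveneers2011_resonantSetProbability := by
  refine AjankiHuveneers2011_resonantSetProbability_of_tails AjankiHuveneers2011_jointBehaviourTails_holds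
    fun bm bp => ?_
  obtain ⟨w₀, hw₀, -, C₃, -, hΘ⟩ := jb_theta_recursion bm bp
  exact ⟨w₀, hw₀, fun w hw B hB n => (hΘ w hw B hB).1 n⟩

/-- **(L), the critical-band lower bound `∫_{[w₋, 1/√N]} 𝔼J_N ≥ C₁ N^{-3/2}`** — DISCHARGED
(`…_criticalBandLowerBound_of_resonantSet`). [cite: AjankiHuveneers2011, §6.1] -/
theorem AjankiHuveneers2011_criticalBandLowerBound_holds : AjankiHuveneers2011_criticalBandLowerBound :=
  AjankiHuveneers2011_criticalBandLowerBound_of_resonantSet AjankiHuveneers2011_resonantSetProbability_holds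

end Literature.Barriers.AtomisticToContinuum

end
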